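import Literature.NumberTheory.Automorphic.Liu2021.AppendixC.AlbaneseTraceDescent
import Literature.NumberTheory.Automorphic.Liu2021.AppendixC.AlbaneseFiniteQuotientTrace
import HarnessLib

/-!
# Invariant homomorphisms on `Alb_X` descend to `Alb_{X/Δ}` up to `|Δ|` (INVENTORY row VI-4, generic AG half — composition)

PROOF FILE (one theorem).  The named fact `AlbaneseTraceOfFiniteQuotient` (`AppendixC/AlbaneseFiniteQuotientTrace.lean`,
[Lang1983AbelianVarieties] Ch. VIII §6) supplies a trace `t : Alb_Y ⟶ Alb_X` with `Alb_p ≫ t = Σ_g Alb_{g}` for a finite group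
quotient `p : X ⟶ Y = X/Δ` of smooth projective schemes in characteristic zero; the kernel-checked reduction
`Albanese.exists_map_comp_eq_zsmul_of_trace` (`AppendixC/AlbaneseTraceDescent.lean`) turns it into descent up to isogeny of
every `Δ`-invariant homomorphism `Alb_X ⟶ B` — the generic half of the consumer predicate
`Sec42Data.HeckeTranslates.IsogenyDescent` (`AppendixC/RestOneLevelInvariantsHom.lean`); the Shimura-side half (that
`u^N_K : X_N → X_K` is the quotient by `K/N` acting through Hecke translates, [Deligne1979ShimuraVarieties] 2.1.2–2.1.4) is not
here.  HC_CM is proved only modulo the 7 printed citations until rung 0 closes.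
-/

set_option autoImplicit false

noncomputable section

open CategoryTheory AlgebraicGeometry
open Literature.AlgebraicGeometry.Motives (SchemeOver AbelianVariety IsProjectiveOver IsSepQuotient)

namespace Literature.NumberTheory.Automorphic.Liu2021.AppendixC

universe u

namespace Albanese

/-- **Descent up to isogeny along a finite quotient** (row VI-4, generic AG half): granted the Albanese trace
(`AlbaneseTraceOfFiniteQuotient`), for a finite group `Δ` acting on a smooth projective `X` over a field of characteristic
zero with smooth projective quotient `p : X ⟶ Y`, every homomorphism `φ : Alb_X ⟶ B` with `Alb_{g} ≫ φ = φ` for all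
`g ∈ Δ` satisfies `Alb_p ≫ ψ = m • φ` for some `ψ : Alb_Y ⟶ B` and an integer `m ≠ 0` (`m = |Δ|`); i.e.
`(Alb_X)_Δ → Alb_Y` is an isogeny on the level of `Hom(−, B)`. [cite: Lang1983AbelianVarieties, Ch. VIII §6 Thm. 13, pp. 224–227] -/
theorem exists_map_comp_eq_zsmul_of_isSepQuotient (hT : AlbaneseTraceOfFiniteQuotient.{u})
    {k : Type u} [Field k] [CharZero k] {X Y : SchemeOver k} {dX dY : ℕ}
    [SmoothOfRelativeDimension dX X.hom] [SmoothOfRelativeDimension dY Y.hom]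
    (hX : IsProjectiveOver X) (hY : IsProjectiveOver Y)
    {Δ : Type u} [Group Δ] [Fintype Δ] (act : Δ →* Aut X) (p : X ⟶ Y) (hp : IsSepQuotient (fun g => act g) p)
    (aX : Albanese X) (aY : Albanese Y) {B : AbelianVariety k} (φ : aX.Alb ⟶ B)
    (hφ : ∀ g : Δ, aX.map aX (act g).hom ≫ φ = φ) :
    ∃ (m : ℤ) (ψ : aY.Alb ⟶ B), m ≠ 0 ∧ aX.map aY p ≫ ψ = m • φ := by
  obtain ⟨t, ht⟩ := hT k X Y dX dY hX hY Δ act p hp aX aY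
  exact exists_map_comp_eq_zsmul_of_trace aX aY (fun g => aX.map aX (act g).hom) p t ht φ hφ

end Albanese

end Literature.NumberTheory.Automorphic.Liu2021.AppendixC

end
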